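import Summits.PneNP.PneNP.Theorems.ChebyshevTracialDesignPseudoMatchingFormRecursion

/-!
# Cell pnp-psdrank, route `ChebyshevTracialDesign`: incidence counts of a `5`-clique and the Petersen sum-of-squares —
# pieces for the threshold certificate `(|W|, k) = (5, 1)` of the pseudo-matching form (crux `TracialDecayExp20`, stmt-PneNP-19878; eng g14, MEMO-14 §2)

Brick `…PseudoMatchingFormRecursion.form_nonneg_of_base` (p561862) reduces Potechin's one-clique PSD statement — and with it matching-side
low-degree pricing `…sum_levelWeight_trace_nonpos_of_lowDegreeM_of_base` — to a FINITE threshold certificate: the pseudo-matching form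
`δ ↦ Σ_{A,A'} δ_A δ_{A'} ν_W(A ∪ A')` is nonnegative on `{A : |A| ≤ k}` for every `W` with `|W| = 4k+1`. This file and its sequel
`…PseudoMatchingBaseOne` prove the certificate for `k = 1` (`|W| = 5`) in the kernel, with no named fact.
* §1 **`quad_nonneg_of_clique_counts`** — an abstract sum of squares: for an incidence structure with the counts of `K_5` (every edge has
  2 ends, every vertex degree 4, two vertices on exactly one common edge, 10 edges) and all reals `c₀`, `c_e`:
  `0 ≤ c₀² + c₀S/2 + (S² + 3Σ_e c_e² − Σ_x m_x²)/8` (`S = Σ c_e`, `m_x = Σ_{e∋x} c_e`), because `96 ×` it is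
  `96(c₀ + S/4)² + Σ_e (6c_e + S − 2Σ_{x∈e} m_x)²` — the Petersen graph `KG(5,2)` has spectrum `{3, 1, −2}` [folklore].
* §2 the clique edge set `W.offDiag.image Sym2.mk` (`mem_cliqueEdges`, `card_cliqueEdges`, `card_ends_eq_two`, `card_edges_at`, `card_edges_at_pair`,
  `card_common_ends_le_one`) — exactly those counts.
* §3 `sum_card_le_one` (a sum over `{A : |A| ≤ 1}` = the `∅` term + the singleton terms), `even_of_pmatch`, `extends_of_isPMOn` (for `n` even a perfect
  matching of a vertex subset extends to one of `K_n`), `not_extends_of_common_end`.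
Stature: support/instrument (finite algebra and counting; no definitions; axioms standard). WHAT THIS IS NOT: not the certificate itself (that is the
sequel), nothing on the dense cell, nothing on psd rank, no P-vs-NP content. Supports stmt-PneNP-19878.
-/

set_option linter.dupNamespace false -- `Summit.PneNP.PneNP.…`: summit = sub-problem (D-0017)

noncomputable section

namespace Summit.PneNP.PneNP.Theorems.ChebyshevTracialDesignPseudoMatchingBaseOne

open Finset Literature.Barriers.PneNP
open Summit.PneNP.PneNP.Theorems.ChebyshevTracialDesignJunta (two_mul_card_eq)

variable {n : ℕ}

/-! ### §1 An abstract sum-of-squares lemma for the edge set of a `5`-clique -/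

/-- **SOS FROM INCIDENCE COUNTS.** Let `E` (edges) and `W` (vertices) be finite sets with an incidence relation such that every edge has
exactly `2` ends in `W`, every vertex lies on exactly `4` edges, two distinct vertices lie on exactly one common edge, and `|E| = 10` (the
incidence structure of `K_5`). Then for all reals `c₀` and `c : E → ℝ`, with `S = Σ_e c_e` and vertex sums `m_x = Σ_{e ∋ x} c_e`:
`0 ≤ c₀² + c₀S/2 + (S² + 3Σ_e c_e² − Σ_x m_x²)/8`; indeed `96 ×` this equals `96(c₀ + S/4)² + Σ_e (6c_e + S − 2Σ_{x ∈ e} m_x)²`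
(the Petersen-graph spectrum `{3, 1, −2}` in disguise). [folklore] -/
theorem quad_nonneg_of_clique_counts {ι V : Type*} (E : Finset ι) (W : Finset V) (inc : V → ι → Prop)
    [∀ x e, Decidable (inc x e)]
    (h2 : ∀ e ∈ E, (W.filter fun x => inc x e).card = 2)
    (hdeg : ∀ x ∈ W, (E.filter fun e => inc x e).card = 4)
    (hpair : ∀ x ∈ W, ∀ y ∈ W, x ≠ y → (E.filter fun e => inc x e ∧ inc y e).card = 1)
    (hE : E.card = 10) (c₀ : ℝ) (c : ι → ℝ) :
    0 ≤ c₀ ^ 2 + c₀ * (∑ e ∈ E, c e) / 2 +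
      ((∑ e ∈ E, c e) ^ 2 + 3 * ∑ e ∈ E, c e ^ 2 - ∑ x ∈ W, (∑ e ∈ E.filter (fun e => inc x e), c e) ^ 2) / 8 := by
  classical
  set S := ∑ e ∈ E, c e with hS
  set m : V → ℝ := fun x => ∑ e ∈ E.filter (fun e => inc x e), c e with hm
  set Mv : ι → ℝ := fun e => ∑ x ∈ W.filter (fun x => inc x e), m x with hMv
  -- (d) Σ_x m_x = 2 S
  have hsum_m : ∑ x ∈ W, m x = 2 * S := by
    simp only [hm, sum_filter]
    rw [sum_comm]
    rw [hS, mul_sum]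
    refine sum_congr rfl fun e he => ?_
    rw [← sum_filter, sum_const, h2 e he]
    simp [two_mul]
  -- (a) Σ_e c_e M_e = Σ_x m_x²
  have hcM : ∑ e ∈ E, c e * Mv e = ∑ x ∈ W, m x ^ 2 := by
    simp only [hMv, mul_sum, sum_filter, mul_ite, mul_zero]
    rw [sum_comm]
    refine sum_congr rfl fun x hx => ?_
    rw [← sum_filter, sq, hm]
    simp only
    rw [sum_mul]
  -- (b) Σ_e M_e = 8 S
  have hsumM : ∑ e ∈ E, Mv e = 8 * S := by
    simp only [hMv, sum_filter]
    rw [sum_comm]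
    have : ∀ x ∈ W, (∑ e ∈ E, if inc x e then m x else 0) = 4 * m x := by
      intro x hx
      rw [← sum_filter, sum_const, hdeg x hx, nsmul_eq_mul]
      norm_num
    rw [sum_congr rfl this, ← mul_sum, hsum_m]
    ring
  -- (c) Σ_e M_e² = 3 Σ_x m_x² + 4 S²
  have hsumM2 : ∑ e ∈ E, Mv e ^ 2 = 3 * ∑ x ∈ W, m x ^ 2 + 4 * S ^ 2 := by
    have hexp : ∀ e ∈ E, Mv e ^ 2 = ∑ x ∈ W, ∑ y ∈ W, if inc x e ∧ inc y e then m x * m y else 0 := by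
      intro e he
      rw [hMv]
      simp only
      rw [sq, sum_mul_sum, sum_filter]
      refine sum_congr rfl fun x hx => ?_
      rw [sum_filter]
      split_ifs with h1
      · refine sum_congr rfl fun y hy => ?_
        simp [h1]
      · symm
        refine sum_eq_zero fun y hy => ?_
        simp [h1]
    rw [sum_congr rfl hexp, sum_comm]
    have hin : ∀ x ∈ W, (∑ e ∈ E, ∑ y ∈ W, if inc x e ∧ inc y e then m x * m y else 0) =
        4 * (m x * m x) + ∑ y ∈ W.erase x, m x * m y := by
      intro x hx
      rw [sum_comm]
      have hy : ∀ y ∈ W, (∑ e ∈ E, if inc x e ∧ inc y e then m x * m y else 0) =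
          ((E.filter fun e => inc x e ∧ inc y e).card : ℝ) * (m x * m y) := by
        intro y hy
        rw [← sum_filter, sum_const, nsmul_eq_mul]
      rw [sum_congr rfl hy, ← add_sum_erase W _ hx]
      congr 1
      · have : (E.filter fun e => inc x e ∧ inc x e) = E.filter fun e => inc x e := by
          ext e; simp
        rw [this, hdeg x hx]; norm_num
      · refine sum_congr rfl fun y hy => ?_
        rw [hpair x hx y (mem_of_mem_erase hy) (ne_of_mem_erase hy).symm]
        simp
    rw [sum_congr rfl hin, sum_add_distrib, ← mul_sum]
    have hoff : ∑ x ∈ W, ∑ y ∈ W.erase x, m x * m y = (∑ x ∈ W, m x) ^ 2 - ∑ x ∈ W, m x ^ 2 := by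
      rw [sq, sum_mul_sum, ← sum_sub_distrib]
      refine sum_congr rfl fun x hx => ?_
      rw [← add_sum_erase W _ hx, sq]
      ring
    rw [hoff, hsum_m]
    have : ∑ x ∈ W, m x * m x = ∑ x ∈ W, m x ^ 2 := sum_congr rfl fun x _ => by rw [sq]
    rw [this]
    ring
  -- the sum of squares
  have hsq : ∑ e ∈ E, (6 * c e + S - 2 * Mv e) ^ 2 =
      36 * ∑ e ∈ E, c e ^ 2 + 6 * S ^ 2 - 12 * ∑ x ∈ W, m x ^ 2 := by
    have : ∀ e ∈ E, (6 * c e + S - 2 * Mv e) ^ 2 =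
        36 * c e ^ 2 + S ^ 2 + 4 * Mv e ^ 2 + 12 * (S * c e) - 24 * (c e * Mv e) - 4 * (S * Mv e) := by
      intro e _; ring
    rw [sum_congr rfl this]
    simp only [sum_add_distrib, sum_sub_distrib, ← mul_sum, sum_const, hE, nsmul_eq_mul, hcM, hsumM, hsumM2]
    push_cast
    ring
  have hsq0 : 0 ≤ ∑ e ∈ E, (6 * c e + S - 2 * Mv e) ^ 2 := sum_nonneg fun e _ => sq_nonneg _
  have hsq1 : 0 ≤ (c₀ + S / 4) ^ 2 := sq_nonneg _
  have hm' : ∑ x ∈ W, (∑ e ∈ E.filter (fun e => inc x e), c e) ^ 2 = ∑ x ∈ W, m x ^ 2 := rfl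
  rw [hm']
  nlinarith [hsq, hsq0, hsq1]




/-! ### §2 The edge set `E(W) = W.offDiag.image (Function.uncurry Sym2.mk)` of the clique on `W` and its incidence counts -/

/-- Membership in the clique edge set: both ends in `W` and not a loop. [folklore] -/
theorem mem_cliqueEdges {W : Finset (Fin n)} {e : Sym2 (Fin n)} :
    e ∈ W.offDiag.image (Function.uncurry Sym2.mk) ↔ (∀ x ∈ e, x ∈ W) ∧ ¬e.IsDiag := by
  constructor
  · intro he
    obtain ⟨⟨a, b⟩, hp, rfl⟩ := mem_image.1 he
    rw [mem_offDiag] at hp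
    simp only [Function.uncurry_apply_pair]
    refine ⟨fun x hx => ?_, by rw [Sym2.mk_isDiag_iff]; exact hp.2.2⟩
    rcases Sym2.mem_iff.1 hx with rfl | rfl
    · exact hp.1
    · exact hp.2.1
  · rintro ⟨hW, hd⟩
    induction e using Sym2.ind with
    | h a b =>
      rw [Sym2.mk_isDiag_iff] at hd
      exact mem_image.2 ⟨(a, b), mem_offDiag.2 ⟨hW a (Sym2.mem_mk_left _ _), hW b (Sym2.mem_mk_right _ _), hd⟩, rfl⟩

/-- `s(a,b)` with `a ≠ b` in `W` is a clique edge. [folklore] -/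
theorem mk_mem_cliqueEdges {W : Finset (Fin n)} {a b : Fin n} (ha : a ∈ W) (hb : b ∈ W) (hab : a ≠ b) :
    s(a, b) ∈ W.offDiag.image (Function.uncurry Sym2.mk) :=
  mem_image.2 ⟨(a, b), mem_offDiag.2 ⟨ha, hb, hab⟩, rfl⟩

/-- (T5) `|E(W)| = C(|W|, 2)`. [folklore] -/
theorem card_cliqueEdges (W : Finset (Fin n)) : (W.offDiag.image (Function.uncurry Sym2.mk)).card = W.card.choose 2 :=
  Sym2.card_image_offDiag W

/-- (T1) Every clique edge has exactly two ends in `W`. [folklore] -/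
theorem card_ends_eq_two {W : Finset (Fin n)} {e : Sym2 (Fin n)} (he : e ∈ W.offDiag.image (Function.uncurry Sym2.mk)) :
    (W.filter fun x => x ∈ e).card = 2 := by
  obtain ⟨hW, hd⟩ := mem_cliqueEdges.1 he
  induction e using Sym2.ind with
  | h a b =>
    rw [Sym2.mk_isDiag_iff] at hd
    have : (W.filter fun x => x ∈ s(a, b)) = {a, b} := by
      ext x
      simp only [mem_filter, Sym2.mem_iff, mem_insert, mem_singleton]
      constructor
      · exact fun h => h.2
      · rintro (rfl | rfl)
        · exact ⟨hW _ (Sym2.mem_mk_left _ _), Or.inl rfl⟩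
        · exact ⟨hW _ (Sym2.mem_mk_right _ _), Or.inr rfl⟩
    rw [this, card_pair hd]

/-- (T3) Every vertex of `W` lies on exactly `|W| − 1` clique edges. [folklore] -/
theorem card_edges_at {W : Finset (Fin n)} {x : Fin n} (hx : x ∈ W) :
    ((W.offDiag.image (Function.uncurry Sym2.mk)).filter fun e => x ∈ e).card = W.card - 1 := by
  have : ((W.offDiag.image (Function.uncurry Sym2.mk)).filter fun e => x ∈ e) = (W.erase x).image fun y => s(x, y) := by
    ext e
    constructor
    · intro h
      obtain ⟨he, hxe⟩ := mem_filter.1 h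
      obtain ⟨hW, hd⟩ := mem_cliqueEdges.1 he
      obtain ⟨y, rfl⟩ : ∃ y, e = s(x, y) := by
        induction e using Sym2.ind with
        | h a b =>
          rcases Sym2.mem_iff.1 hxe with rfl | rfl
          · exact ⟨b, rfl⟩
          · exact ⟨a, Sym2.eq_swap⟩
      rw [Sym2.mk_isDiag_iff] at hd
      exact mem_image.2 ⟨y, mem_erase.2 ⟨fun h => hd h.symm, hW y (Sym2.mem_mk_right _ _)⟩, rfl⟩
    · intro h
      obtain ⟨y, hy, rfl⟩ := mem_image.1 h
      obtain ⟨hyx, hyW⟩ := mem_erase.1 hy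
      exact mem_filter.2 ⟨mk_mem_cliqueEdges hx hyW (fun h => hyx h.symm), Sym2.mem_mk_left _ _⟩
  rw [this, card_image_of_injOn, card_erase_of_mem hx]
  intro y _ y' _ h
  have h' : s(x, y) = s(x, y') := h
  rcases Sym2.eq_iff.1 h' with ⟨-, h1⟩ | ⟨h1, h2⟩
  · exact h1
  · rw [← h1, h2]

/-- (T4) Two distinct vertices of `W` lie on exactly one common clique edge. [folklore] -/
theorem card_edges_at_pair {W : Finset (Fin n)} {x y : Fin n} (hx : x ∈ W) (hy : y ∈ W) (hxy : x ≠ y) :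
    ((W.offDiag.image (Function.uncurry Sym2.mk)).filter fun e => x ∈ e ∧ y ∈ e).card = 1 := by
  rw [card_eq_one]
  refine ⟨s(x, y), ?_⟩
  ext e
  simp only [mem_filter, mem_singleton]
  constructor
  · rintro ⟨-, hxe, hye⟩
    induction e using Sym2.ind with
    | h a b =>
      rcases Sym2.mem_iff.1 hxe with rfl | rfl <;> rcases Sym2.mem_iff.1 hye with rfl | rfl
      · exact absurd rfl hxy
      · rfl
      · exact Sym2.eq_swap
      · exact absurd rfl hxy
  · rintro rfl
    exact ⟨mk_mem_cliqueEdges hx hy hxy, Sym2.mem_mk_left _ _, Sym2.mem_mk_right _ _⟩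

/-- (T2) Two DISTINCT clique edges have at most one common end. [folklore] -/
theorem card_common_ends_le_one {W : Finset (Fin n)} {e f : Sym2 (Fin n)} (he : e ∈ W.offDiag.image (Function.uncurry Sym2.mk))
    (hef : e ≠ f) : (W.filter fun x => x ∈ e ∧ x ∈ f).card ≤ 1 := by
  obtain ⟨-, hd⟩ := mem_cliqueEdges.1 he
  rw [card_le_one]
  intro x hx y hy
  obtain ⟨-, hxe, hxf⟩ := mem_filter.1 hx
  obtain ⟨-, hye, hyf⟩ := mem_filter.1 hy
  by_contra hxy
  apply hef
  induction e using Sym2.ind with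
  | h a b =>
    induction f using Sym2.ind with
    | h c d =>
      -- `{x, y} = {a, b}` and `{x, y} ⊆ {c, d}` with `x ≠ y`
      rcases Sym2.mem_iff.1 hxe with rfl | rfl <;> rcases Sym2.mem_iff.1 hye with rfl | rfl
      · exact absurd rfl hxy
      · rcases Sym2.mem_iff.1 hxf with rfl | rfl <;> rcases Sym2.mem_iff.1 hyf with rfl | rfl
        · exact absurd rfl hxy
        · rfl
        · exact Sym2.eq_swap
        · exact absurd rfl hxy
      · rcases Sym2.mem_iff.1 hxf with rfl | rfl <;> rcases Sym2.mem_iff.1 hyf with rfl | rfl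
        · exact absurd rfl hxy
        · exact Sym2.eq_swap
        · rfl
        · exact absurd rfl hxy
      · exact absurd rfl hxy

/-! ### §3 Sums over `{A : |A| ≤ 1}`; extension of partial matchings -/

/-- A sum over the edge sets of size `≤ 1` is the empty-set term plus the singleton terms. [folklore] -/
theorem sum_card_le_one {α : Type*} [Fintype α] [DecidableEq α] (g : {A : Finset α // A.card ≤ 1} → ℝ) :
    ∑ A, g A = g ⟨∅, by simp⟩ + ∑ a, g ⟨{a}, by simp⟩ := by
  classical
  set F : Finset α → ℝ := fun A => if h : A.card ≤ 1 then g ⟨A, h⟩ else 0 with hF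
  have hFg : ∀ A : {A : Finset α // A.card ≤ 1}, g A = F A.1 := fun A => by rw [hF]; simp only [A.2, dif_pos]
  simp only [hFg]
  rw [← Finset.sum_subtype (s := (univ : Finset (Finset α)).filter (fun A => A.card ≤ 1))
    (p := fun A : Finset α => A.card ≤ 1) (fun A => by simp) (f := F)]
  have hsplit : (univ : Finset (Finset α)).filter (fun A => A.card ≤ 1) =
      (univ : Finset α).powersetCard 0 ∪ (univ : Finset α).powersetCard 1 := by
    ext A; simp only [mem_filter, mem_univ, true_and, mem_union, mem_powersetCard_univ]; omega
  have hdisj : Disjoint ((univ : Finset α).powersetCard 0) ((univ : Finset α).powersetCard 1) := by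
    rw [disjoint_left]; intro A h0 h1
    rw [mem_powersetCard_univ] at h0 h1; omega
  rw [hsplit, sum_union hdisj, powersetCard_zero, sum_singleton, powersetCard_one, sum_map]
  rfl

/-- A perfect matching of `K_n` forces `n` even. [folklore] -/
theorem even_of_pmatch (M : PMatch n) : Even n := by
  have h := two_mul_card_eq M.2
  rw [card_univ, Fintype.card_fin] at h
  exact ⟨M.1.card, by omega⟩

/-- For `n` even, a perfect matching of a vertex SUBSET extends to a perfect matching of `K_n` containing it. [folklore] -/
theorem extends_of_isPMOn (hn : Even n) {S : Finset (Fin n)} {G : Finset (Sym2 (Fin n))} (hG : IsPMOn S G) :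
    ((univ : Finset (PMatch n)).filter fun M => G ⊆ M.1).Nonempty := by
  classical
  set R := (univ : Finset (Fin n)) \ S with hR
  have hReven : Even R.card := by
    rw [hR, card_sdiff_of_subset (subset_univ _), card_univ, Fintype.card_fin, ← two_mul_card_eq hG]
    obtain ⟨a, ha⟩ := hn
    exact ⟨a - G.card, by omega⟩
  obtain ⟨N, hN⟩ := exists_isPMOn_of_even R.card R rfl hReven
  have hPM : IsPMOn (S ∪ R) (G ∪ N) := hG.union hN disjoint_sdiff
  rw [union_sdiff_of_subset (subset_univ _)] at hPM
  exact ⟨⟨G ∪ N, hPM⟩, mem_filter.2 ⟨mem_univ _, subset_union_left⟩⟩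

/-- No perfect matching contains two distinct edges with a common end. [folklore] -/
theorem not_extends_of_common_end {e f : Sym2 (Fin n)} (hef : e ≠ f) {x : Fin n} (hxe : x ∈ e) (hxf : x ∈ f) :
    ¬((univ : Finset (PMatch n)).filter fun M => ({e} ∪ {f} : Finset (Sym2 (Fin n))) ⊆ M.1).Nonempty := by
  rintro ⟨M, hM⟩
  have hsub := (mem_filter.1 hM).2
  exact hef (M.2.unique (hsub (by simp)) (hsub (by simp)) hxe hxf)

end Summit.PneNP.PneNP.Theorems.ChebyshevTracialDesignPseudoMatchingBaseOne
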